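import Summits.BirchSwinnertonDyer.BirchSwinnertonDyer.Theorems.ManinLocalTwoThreeCuspLiftingHolds
import Summits.BirchSwinnertonDyer.BirchSwinnertonDyer.Theorems.ManinLocalTwoThreeShimuraIndexAtTwoExponent
import Summits.BirchSwinnertonDyer.BirchSwinnertonDyer.Theorems.ManinLocalTwoThreeShimuraIndexOfIrreducible
import Literature.NumberTheory.EllipticCurves.PrimeConductorTwoTorsionProofs
import Literature.NumberTheory.EllipticCurves.TwoIsogenyDescentOddMultipleProofs
import Literature.NumberTheory.EllipticCurves.VariableChangePoints
import Literature.NumberTheory.Automorphic.ShimuraCurveRibetTakahashiSemistableManinProofs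
import Literature.NumberTheory.EllipticCurves.PeriodLatticeGamma1QuotientProofs
import Literature.NumberTheory.EllipticCurves.ModularCurveNonempty
import HarnessLib

/-!
# The Shimura quotient at PRIME level has no element of order `4` (except at `q = 17`) — R4♯ and the
# Derickx–Orlić exponent law at every prime level `q ≢ 1 (mod 5)`

es g42 (cell bsd-f2-manin, LENS Euler-system / explicit reciprocity), MEMO-es §65; route `ManinLocalTwoThree`, crux C2 `ManinOddAtFour`
stmt-BirchSwinnertonDyer-22967 (helper toward the Derickx–Orlić exponent question E-es-193 at prime level).

For an elliptic `W/ℚ` and an `X₀(q)`-datum `D` at a PRIME level `q` that is LATTICE-OPTIMAL (`L(D) = c · Λ₀(f)`, the hypothesis `hopt`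
of the tree's cusp-lifting glue `CuspLifting.exists_addOrderOf_eq_primePow`):

* §1 `conductorNorm_eq_of_squarefree_level` — at SQUAREFREE (e.g. prime) level the level is the conductor, unconditionally: the datum
  form of the tree's `IsNewformOf.level_eq_conductorNorm_of_squarefree_level` (Ribet–Takahashi/semistable-Manin file; `p² ∣ N_W` would make
  `W` additive at `p`, so `a_p(W) = 0`, while `p ∥ N` forces `a_p(f)² = 1`, Atkin–Lehner Thm. 3) — cited, not re-proved.
* §2 `addOrderOf_ne_four_of_twoTorsionNF` — on `y² = x³ + ax² + bx` over `ℚ` with `a² − 4b` and `b` non-squares there is no rational point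
  of order `4` (the tree's `E(ℚ)[2^∞] = {O, T}`, `eq_zero_or_eq_twoTorsionPoint_of_two_pow_nsmul_eq_zero`, Silverman–Tate §3.5); hence
  `addOrderOf_ne_four_of_prime_conductorNorm`: **an elliptic curve of PRIME conductor `≠ 17` has no rational point of order `4`** — a point
  of order `4` gives one of order `2`, Setzer's theorem (tree THEOREM `Setzer1975_primeConductor_rationalTwoTorsion_holds`) makes `W` a
  Neumann–Setzer curve `E₀(u)`/`E₁(u)` with `N_W = u² + 64` prime, whose `2`-torsion normal forms `y² = x³ + 2ux² + (u² + 64)x`,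
  `y² = x³ − ux² − 16x` (tree `PrimeConductorTwoTorsion.smul_eq_twoTorsionModel`) have `(b, a² − 4b) = (u² + 64, −256)`, `(−16, u² + 64)`:
  a prime and a negative number, neither a square.
* §3 `two_mul_mem_of_four_mul_mem_primeLevel` — **the Shimura quotient `Λ₀(f)/Λ₁(f)` at prime level `q ≠ 17` has NO element of order
  `4`** (lattice-optimal data): an `x ∈ Λ₀` with `4x ∈ Λ₁`, `2x ∉ Λ₁` would give a rational point of order `4` on `W` by the cusp-lifting
  glue; hence (`two_mul_mem_of_two_pow_mul_mem_primeLevel`) the `2`-part of the exponent of `Λ₀/Λ₁` divides `2`.  With the odd Eisenstein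
  input at `2` (tree `ShimuraIndexAtTwo.oddLevelEisensteinAtTwo`: `(a₂(W) − 3)Λ₀ ⊆ Λ₁`, `|a₂(W)| ≤ 2`):
  `two_mul_mem_primeLevel_of_frobeniusTrace_two_eq_neg_one` — **R4♯ (row E-es-211 `ShimuraNoFourTorsionOfNonsplitTwo`) HOLDS AT EVERY
  PRIME LEVEL `q ≠ 17`** for lattice-optimal data (`a₂(W) = −1 ⟹ 2Λ₀(f) ⊆ Λ₁(f)`), and
  `two_mul_mem_or_three_mul_mem_primeLevel` — **the Derickx–Orlić shape `2Λ₀ ⊆ Λ₁ ∨ 3Λ₀ ⊆ Λ₁` at every prime level `q ≥ 18`,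
  `q ≢ 1 (mod 5)`** (lattice-optimal data of globally minimal curves), and at `q ≡ 1 (mod 5)` whenever `a₂(W) ≠ −2`.  At `q = 17` the class
  `17a` has `Λ₀/Λ₁ ≅ ℤ/4` (E15), so `q ≠ 17` is sharp; the prime-level residue is exactly `q ≡ 1 (mod 5) ∧ a₂(W) = −2` (rational
  `5`-torsion at prime conductor `⟹ q = 11`, Miyawaki 1973 — not in the tree).

HONEST FRAMING: unconditional tree theorems (standard axioms); no definitions, no named facts, no sorry.  C2, C3, the Derickx–Orlić question
in general, Manin's conjecture and BSD are NOT proved by this file.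
[cite: Setzer1975, Thm 2] [cite: Mazur1977, III §7 (p. 162)] [cite: SilvermanTate2015, §3.5] [cite: AtkinLehner1970, Thm. 3]
[cite: LingOesterle1991, Thm. 1 and Thm. 6] [cite: DerickxOrlic2025, Rmk. 4.8] [cite: SteinWatkins2004, §1 (PDF p. 3)]
-/

set_option autoImplicit false
-- lint-debt: the directory name repeats the summit name (sibling precedent `ManinLocalTwoThreeShimuraIndexAtTwo.lean`)
set_option linter.dupNamespace false

noncomputable section

open scoped MatrixGroups ModularForm

open CongruenceSubgroup WeierstrassCurve Literature.NumberTheory.EllipticCurves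
  Literature.NumberTheory.EllipticCurves.ModularForms Literature.NumberTheory.EllipticCurves.Greenberg1999
  IsDedekindDomain NumberField Rat.HeightOneSpectrum
open Summit.BirchSwinnertonDyer.Rank1Residual.ManinAdditive.KatoCurve

namespace Summit.BirchSwinnertonDyer.BirchSwinnertonDyer.Theorems.ManinLocalTwoThree.ShimuraPrimeLevelAtTwo

/-! ### §1. At squarefree level the level is the conductor (unconditional; tree theorem, datum form) -/

section Level

variable {W : WeierstrassCurve ℚ} {N : ℕ} [NeZero N]

/-- Datum form of the tree's `IsNewformOf.level_eq_conductorNorm_of_squarefree_level`: an `X₀(N)`-datum at SQUAREFREE level `N` has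
`N_W = N`; in particular at PRIME level `N_W = q`. [cite: AtkinLehner1970, Thm. 3] [cite: DiamondShurman2005, Thm. 8.8.1 and (8.44)] -/
theorem conductorNorm_eq_of_squarefree_level (D : ModularParametrizationData W N) (hsq : Squarefree N) : W.conductorNorm ℤ = N := by
  haveI := D.isElliptic
  exact (D.isNewformOf.level_eq_conductorNorm_of_squarefree_level hsq).symm

end Level

/-! ### §2. No rational point of order `4`: two-torsion normal forms, Neumann–Setzer curves, prime conductor `≠ 17` -/

section NoFourTorsion

/-- **`y² = x³ + ax² + bx` over `ℚ` with `a² − 4b` and `b` non-squares has no rational point of order `4`** (`E(ℚ)[2^∞] = {O, T}`, tree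
`eq_zero_or_eq_twoTorsionPoint_of_two_pow_nsmul_eq_zero`). [cite: SilvermanTate2015, §3.5] -/
theorem addOrderOf_ne_four_of_twoTorsionNF (V : WeierstrassCurve ℚ) [V.IsTwoTorsionNF] [V.IsElliptic]
    (hD : ¬ IsSquare (V.a₂ ^ 2 - 4 * V.a₄)) (hb : ¬ IsSquare V.a₄) (Q : V.toAffine.Point) : addOrderOf Q ≠ 4 := by
  intro h4
  have h40 : 2 ^ 2 • Q = 0 := by
    rw [show (2 ^ 2 : ℕ) = addOrderOf Q by rw [h4]; norm_num]
    exact addOrderOf_nsmul_eq_zero Q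
  -- the tree lemmas are stated with the classical `DecidableEq ℚ` of their file; bridge by `Subsingleton.elim`
  have key : ∀ [d : DecidableEq ℚ], (2 ^ 2 • Q = 0 → Q = 0 ∨ Q = V.twoTorsionPoint) := by
    intro d
    obtain rfl : d = fun a b => Classical.propDecidable (a = b) := Subsingleton.elim _ _
    exact V.eq_zero_or_eq_twoTorsionPoint_of_two_pow_nsmul_eq_zero hD hb 2 Q
  have hTT : ∀ [d : DecidableEq ℚ], V.twoTorsionPoint + V.twoTorsionPoint = 0 := by
    intro d
    obtain rfl : d = fun a b => Classical.propDecidable (a = b) := Subsingleton.elim _ _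
    exact twoTorsionPoint_add_twoTorsionPoint V
  rcases key h40 with h0 | hT
  · rw [h0, addOrderOf_zero] at h4
    exact absurd h4 (by norm_num)
  · have h2T : 2 • Q = 0 := by rw [hT, two_nsmul]; exact hTT
    have hdvd : addOrderOf Q ∣ 2 := addOrderOf_dvd_of_nsmul_eq_zero h2T
    rw [h4] at hdvd
    exact absurd hdvd (by norm_num)

/-- Transport: if `C • W = V` and `V(ℚ)` has no point of order `4`, neither has `W(ℚ)` (tree `VariableChange.pointEquiv`,
an isomorphism of groups). [cite: SilvermanAEC2009, III.3.1(b)] -/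
theorem addOrderOf_ne_four_of_smul_eq {W V : WeierstrassCurve ℚ} (C : VariableChange ℚ) (hV : C • W = V)
    (hV4 : ∀ P : V.toAffine.Point, addOrderOf P ≠ 4) (Q : W.toAffine.Point) : addOrderOf Q ≠ 4 := by
  subst hV
  intro h4
  exact hV4 (VariableChange.pointEquiv W C Q) (by rw [AddEquiv.addOrderOf_eq, h4])

/-- **No rational point of order `4` on a curve `ℚ`-isomorphic to the Neumann–Setzer curve `E₁(u)`**, `u² + 64` not a square: its
normal form at `(0, 0)` is `y² = x³ − ux² − 16x` (`b = −16 < 0`, `a² − 4b = u² + 64`). [cite: Mazur1977, III §7 (p. 162)] -/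
theorem addOrderOf_ne_four_of_smul_eq_neumannSetzerCurve₁ {W : WeierstrassCurve ℚ} [W.IsElliptic] (u : ℤ)
    (hu : ¬ IsSquare ((u : ℚ) ^ 2 + 64)) (C : VariableChange ℚ) (hW : C • W = neumannSetzerCurve₁ u) (Q : W.toAffine.Point) :
    addOrderOf Q ≠ 4 := by
  set C₂ : VariableChange ℚ := ⟨⟨1 / 2, 2, by norm_num, by norm_num⟩, 0, -(neumannSetzerCurve₁ u).a₁ / 2, 0⟩ with hC₂
  have hNF : C₂ • neumannSetzerCurve₁ u = ⟨0, -(u : ℚ), 0, -16, 0⟩ := by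
    rw [hC₂, PrimeConductorTwoTorsion.smul_eq_twoTorsionModel (neumannSetzerCurve₁ u) (x₀ := 0) (y₀ := 0)
      (by rw [WeierstrassCurve.Affine.equation_iff]; simp [neumannSetzerCurve₁]) (by simp [neumannSetzerCurve₁])]
    ext <;> simp [neumannSetzerCurve₁, WeierstrassCurve.b₂, WeierstrassCurve.b₄] <;> ring
  have hV : (C₂ * C) • W = ⟨0, -(u : ℚ), 0, -16, 0⟩ := by rw [mul_smul, hW, hNF]
  haveI hE : (⟨0, -(u : ℚ), 0, -16, 0⟩ : WeierstrassCurve ℚ).IsElliptic := by rw [← hV]; infer_instance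
  refine addOrderOf_ne_four_of_smul_eq (C₂ * C) hV (fun P ↦ addOrderOf_ne_four_of_twoTorsionNF _ ?_ ?_ P) Q
  · have e : (⟨0, -(u : ℚ), 0, -16, 0⟩ : WeierstrassCurve ℚ).a₂ ^ 2 - 4 * (⟨0, -(u : ℚ), 0, -16, 0⟩ : WeierstrassCurve ℚ).a₄ =
        (u : ℚ) ^ 2 + 64 := by ring
    rw [e]; exact hu
  · rintro ⟨r, hr⟩
    have hr' : (-16 : ℚ) = r * r := hr
    nlinarith [mul_self_nonneg r]

/-- **No rational point of order `4` on a curve `ℚ`-isomorphic to the Neumann–Setzer curve `E₀(u)`**, `u² + 64` not a square: its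
normal form at `(u/4, −u/8)` is `y² = x³ + 2ux² + (u² + 64)x` (`b = u² + 64`, `a² − 4b = −256 < 0`). [cite: Mazur1977, III §7 (p. 162)] -/
theorem addOrderOf_ne_four_of_smul_eq_neumannSetzerCurve₀ {W : WeierstrassCurve ℚ} [W.IsElliptic] (u : ℤ)
    (hu : ¬ IsSquare ((u : ℚ) ^ 2 + 64)) (C : VariableChange ℚ) (hW : C • W = neumannSetzerCurve₀ u) (Q : W.toAffine.Point) :
    addOrderOf Q ≠ 4 := by
  set C₂ : VariableChange ℚ :=
    ⟨⟨1 / 2, 2, by norm_num, by norm_num⟩, (u : ℚ) / 4, -(neumannSetzerCurve₀ u).a₁ / 2, -((u : ℚ) / 8)⟩ with hC₂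
  have hNF : C₂ • neumannSetzerCurve₀ u = ⟨0, 2 * (u : ℚ), 0, (u : ℚ) ^ 2 + 64, 0⟩ := by
    rw [hC₂, PrimeConductorTwoTorsion.smul_eq_twoTorsionModel (neumannSetzerCurve₀ u) (x₀ := (u : ℚ) / 4) (y₀ := -((u : ℚ) / 8))
      (by rw [WeierstrassCurve.Affine.equation_iff]; simp only [neumannSetzerCurve₀]; ring) (by simp only [neumannSetzerCurve₀]; ring)]
    ext <;> simp [neumannSetzerCurve₀, WeierstrassCurve.b₂, WeierstrassCurve.b₄] <;> ring
  have hV : (C₂ * C) • W = ⟨0, 2 * (u : ℚ), 0, (u : ℚ) ^ 2 + 64, 0⟩ := by rw [mul_smul, hW, hNF]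
  haveI hE : (⟨0, 2 * (u : ℚ), 0, (u : ℚ) ^ 2 + 64, 0⟩ : WeierstrassCurve ℚ).IsElliptic := by rw [← hV]; infer_instance
  refine addOrderOf_ne_four_of_smul_eq (C₂ * C) hV (fun P ↦ addOrderOf_ne_four_of_twoTorsionNF _ ?_ ?_ P) Q
  · rintro ⟨r, hr⟩
    have hr' : (2 * (u : ℚ)) ^ 2 - 4 * ((u : ℚ) ^ 2 + 64) = r * r := hr
    nlinarith [mul_self_nonneg r]
  · exact hu

/-- A rational point of order `2` yields the tree predicate `HasRationalTwoTorsionX W x` at its abscissa (`P = (x, y) = −P` forces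
`2y + a₁x + a₃ = 0`; same statement as the sibling `AlignedTransportAtTwoSeed.exists_hasRationalTwoTorsionX_of_addOrderOf_eq_two`,
restated here to keep this file's imports inside the `ManinLocalTwoThree` cone). [cite: SilvermanAEC2009, III.2.3] -/
theorem exists_hasRationalTwoTorsionX_of_addOrderOf_eq_two (W : WeierstrassCurve ℚ) {P : W.toAffine.Point} (hP : addOrderOf P = 2) :
    ∃ x : ℚ, HasRationalTwoTorsionX W x := by
  have h2 : (2 : ℕ) • P = 0 := by rw [← hP]; exact addOrderOf_nsmul_eq_zero P
  have hP0 : P ≠ 0 := by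
    rintro rfl
    rw [addOrderOf_zero] at hP
    exact absurd hP (by norm_num)
  rcases P with _ | ⟨x, y, hns⟩
  · exact absurd rfl hP0
  · refine ⟨x, y, hns.1, ?_⟩
    have hneg : (WeierstrassCurve.Affine.Point.some x y hns : W.toAffine.Point) = -WeierstrassCurve.Affine.Point.some x y hns :=
      eq_neg_of_add_eq_zero_left (by rwa [two_nsmul] at h2)
    rw [WeierstrassCurve.Affine.Point.neg_some, WeierstrassCurve.Affine.Point.some.injEq] at hneg
    have hy := hneg.2
    simp only [WeierstrassCurve.Affine.negY] at hy
    linarith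

/-- **An elliptic curve over `ℚ` of PRIME conductor `≠ 17` has no rational point of order `4`.**  `2Q` has order `2`; by Setzer's theorem
(tree theorem `Setzer1975_primeConductor_rationalTwoTorsion_holds`) `W ≅ E₀(u)` or `E₁(u)` with `N_W = u² + 64` prime, hence not a square.
(Sharp: `17a1` has `W(ℚ) ≅ ℤ/4`.) [cite: Setzer1975, Thm 2] [cite: Mazur1977, III §7 (p. 162)] -/
theorem addOrderOf_ne_four_of_prime_conductorNorm (W : WeierstrassCurve ℚ) [W.IsElliptic] (hN : (W.conductorNorm ℤ).Prime)
    (h17 : W.conductorNorm ℤ ≠ 17) (Q : W.toAffine.Point) : addOrderOf Q ≠ 4 := by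
  intro h4
  have h2 : addOrderOf (2 • Q) = 2 := by
    rw [addOrderOf_nsmul_of_dvd two_ne_zero (by rw [h4]; norm_num), h4]
  obtain ⟨x, hx⟩ := exists_hasRationalTwoTorsionX_of_addOrderOf_eq_two W h2
  rcases Setzer1975_primeConductor_rationalTwoTorsion_holds W x hx hN with h17' | ⟨u, -, hNu, C, hC⟩
  · exact h17 h17'
  · have hu : ¬ IsSquare ((u : ℚ) ^ 2 + 64) := by
      have e : (u : ℚ) ^ 2 + 64 = ((W.conductorNorm ℤ : ℕ) : ℚ) := by
        have h := congrArg (Int.cast : ℤ → ℚ) hNu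
        push_cast at h
        linarith
      rw [e, Rat.isSquare_natCast_iff]
      exact hN.prime.not_isSquare
    rcases hC with h₀ | h₁
    · exact addOrderOf_ne_four_of_smul_eq_neumannSetzerCurve₀ u hu C h₀ Q h4
    · exact addOrderOf_ne_four_of_smul_eq_neumannSetzerCurve₁ u hu C h₁ Q h4

end NoFourTorsion

/-! ### §3. Prime level: no Shimura element of order `4`; R4♯; the Derickx–Orlić shape for `q ≢ 1 (mod 5)` -/

section PrimeLevel

variable {W : WeierstrassCurve ℚ} [W.IsElliptic] {q : ℕ} [NeZero q]

omit [W.IsElliptic] in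
/-- A prime level carrying a datum is odd (`X₀(2)` has genus `0`: tree `ModularParametrizationData_isEmpty_of_mem_genusZeroLevels`).
[cite: DiamondShurman2005, Thm. 3.5.1] -/
theorem not_two_dvd_of_prime_level (D : ModularParametrizationData W q) (hq : q.Prime) : ¬ 2 ∣ q := by
  intro h2
  have h := (Nat.prime_dvd_prime_iff_eq Nat.prime_two hq).mp h2
  subst h
  exact (ModularParametrizationData_isEmpty_of_mem_genusZeroLevels W 2 (by decide)).false D

/-- **The Shimura quotient `Λ₀(f)/Λ₁(f)` at PRIME level `q ≠ 17` has no element of order `4`** (lattice-optimal data): `x ∈ Λ₀`,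
`4x ∈ Λ₁ ⟹ 2x ∈ Λ₁`.  An `x` with `4x ∈ Λ₁`, `2x ∉ Λ₁` gives a rational point of order `4` on `W` (cusp-lifting glue
`CuspLifting.exists_addOrderOf_eq_primePow`), impossible at prime conductor `q = N_W ≠ 17` (§1, §2).
[cite: Setzer1975, Thm 2] [cite: Vatsal2005, Rem. 1.18] [cite: DerickxOrlic2025, Rmk. 4.8] -/
theorem two_mul_mem_of_four_mul_mem_primeLevel (D : ModularParametrizationData W q)
    (hopt : ∀ z ∈ D.L.lattice, ∃ w ∈ periodLattice D.f, z = D.c * w) (hq : q.Prime) (h17 : q ≠ 17)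
    {x : ℂ} (hx : x ∈ periodLattice D.f) (h4 : 4 * x ∈ periodLatticeGamma1 D.f) : 2 * x ∈ periodLatticeGamma1 D.f := by
  by_contra h2
  have hx' : ∃ x ∈ periodLattice D.f, ((2 ^ 2 : ℕ) : ℂ) * x ∈ periodLatticeGamma1 D.f ∧
      ((2 ^ (2 - 1) : ℕ) : ℂ) * x ∉ periodLatticeGamma1 D.f :=
    ⟨x, hx, by norm_num; exact h4, by norm_num; exact h2⟩
  obtain ⟨Q, hQ⟩ := CuspLifting.exists_addOrderOf_eq_primePow D hopt Nat.prime_two hx'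
  have hNq : W.conductorNorm ℤ = q := conductorNorm_eq_of_squarefree_level D hq.prime.squarefree
  have hN : (W.conductorNorm ℤ).Prime := by rw [hNq]; exact hq
  exact addOrderOf_ne_four_of_prime_conductorNorm W hN (by rw [hNq]; exact h17) Q (by rw [hQ]; norm_num)

/-- **The `2`-part of the exponent of `Λ₀(f)/Λ₁(f)` divides `2` at prime level `q ≠ 17`** (lattice-optimal data): `2ᵏx ∈ Λ₁ ⟹ 2x ∈ Λ₁`.
[cite: Setzer1975, Thm 2] [cite: DerickxOrlic2025, Rmk. 4.8] -/
theorem two_mul_mem_of_two_pow_mul_mem_primeLevel (D : ModularParametrizationData W q)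
    (hopt : ∀ z ∈ D.L.lattice, ∃ w ∈ periodLattice D.f, z = D.c * w) (hq : q.Prime) (h17 : q ≠ 17) :
    ∀ (k : ℕ) {x : ℂ}, x ∈ periodLattice D.f → (2 : ℂ) ^ k * x ∈ periodLatticeGamma1 D.f → 2 * x ∈ periodLatticeGamma1 D.f
  | 0, x, hx, h => by
    rw [pow_zero, one_mul] at h
    simpa [two_mul] using (periodLatticeGamma1 D.f).add_mem h h
  | k + 1, x, hx, h => by
    have hy : 2 * x ∈ periodLattice D.f := by simpa [two_mul] using (periodLattice D.f).add_mem hx hx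
    have h' : (2 : ℂ) ^ k * (2 * x) ∈ periodLatticeGamma1 D.f := by
      convert h using 1; ring
    have h4 : 4 * x ∈ periodLatticeGamma1 D.f := by
      convert two_mul_mem_of_two_pow_mul_mem_primeLevel D hopt hq h17 k hy h' using 1; ring
    exact two_mul_mem_of_four_mul_mem_primeLevel D hopt hq h17 hx h4

variable [W.IsGloballyMinimal]

/-- **R4♯ (row E-es-211 `ShimuraNoFourTorsionOfNonsplitTwo`) at every PRIME level `q ≠ 17`, lattice-optimal data:**
`a₂(W) = −1 ⟹ 2Λ₀(f) ⊆ Λ₁(f)`.  (`(a₂ − 3)Λ₀ = −4Λ₀ ⊆ Λ₁` by the odd Eisenstein input at `2`, tree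
`ShimuraIndexAtTwo.oddLevelEisensteinAtTwo`; then `two_mul_mem_of_four_mul_mem_primeLevel`.)  The residue class `q ≡ 1 (mod 8)` of the sieved
prime-level rung (MEMO-es §64.12) is thereby closed. [cite: LingOesterle1991, Thm. 6] [cite: Setzer1975, Thm 2] [cite: DerickxOrlic2025, Rmk. 4.8] -/
theorem two_mul_mem_primeLevel_of_frobeniusTrace_two_eq_neg_one (D : ModularParametrizationData W q)
    (hopt : ∀ z ∈ D.L.lattice, ∃ w ∈ periodLattice D.f, z = D.c * w) (hq : q.Prime) (h17 : q ≠ 17) (ha : W.frobeniusTrace 2 = -1) :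
    ∀ z ∈ periodLattice D.f, 2 * z ∈ periodLatticeGamma1 D.f := by
  intro z hz
  obtain ⟨-, hmem⟩ := ShimuraIndexAtTwo.oddLevelEisensteinAtTwo W D.f D.isNewformOf (not_two_dvd_of_prime_level D hq)
  have h4 : 4 * z ∈ periodLatticeGamma1 D.f := by
    have h := (periodLatticeGamma1 D.f).neg_mem (hmem z hz)
    rw [ha] at h
    convert h using 1
    push_cast
    ring
  exact two_mul_mem_of_four_mul_mem_primeLevel D hopt hq h17 hz h4

/-- **The Derickx–Orlić shape at PRIME level when `a₂(W) ≠ −2`** (lattice-optimal data, `q ≠ 17`): `2Λ₀(f) ⊆ Λ₁(f) ∨ 3Λ₀(f) ⊆ Λ₁(f)`.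
Cases on `a₂(W) ∈ {−1, 0, 1, 2}` (`|a₂| ≤ 2`, `(a₂ − 3)Λ₀ ⊆ Λ₁`): `−1` is R4♯ above; `0` gives `3Λ₀ ⊆ Λ₁`; `1, 2` give `2Λ₀ ⊆ Λ₁`.
[cite: LingOesterle1991, Thm. 6] [cite: DerickxOrlic2025, Rmk. 4.8] -/
theorem two_mul_mem_or_three_mul_mem_primeLevel_of_frobeniusTrace_two_ne (D : ModularParametrizationData W q)
    (hopt : ∀ z ∈ D.L.lattice, ∃ w ∈ periodLattice D.f, z = D.c * w) (hq : q.Prime) (h17 : q ≠ 17) (ha : W.frobeniusTrace 2 ≠ -2) :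
    (∀ z ∈ periodLattice D.f, 2 * z ∈ periodLatticeGamma1 D.f) ∨ (∀ z ∈ periodLattice D.f, 3 * z ∈ periodLatticeGamma1 D.f) := by
  obtain ⟨habs, hmem⟩ := ShimuraIndexAtTwo.oddLevelEisensteinAtTwo W D.f D.isNewformOf (not_two_dvd_of_prime_level D hq)
  obtain ⟨hlo, hhi⟩ := abs_le.mp habs
  have hcases : W.frobeniusTrace 2 = -1 ∨ W.frobeniusTrace 2 = 0 ∨ W.frobeniusTrace 2 = 1 ∨ W.frobeniusTrace 2 = 2 := by omega
  rcases hcases with ha' | ha' | ha' | ha'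
  · exact Or.inl (two_mul_mem_primeLevel_of_frobeniusTrace_two_eq_neg_one D hopt hq h17 ha')
  · exact Or.inr fun z hz ↦ ShimuraIndexAtTwo.three_mul_mem_of_intCast_mul_mem (c := W.frobeniusTrace 2 - 3) (by omega) (hmem z hz)
  · exact Or.inl fun z hz ↦ ShimuraIndexAtTwo.two_mul_mem_of_intCast_mul_mem (c := W.frobeniusTrace 2 - 3) (by omega) (hmem z hz)
  · exact Or.inl fun z hz ↦ ShimuraIndexAtTwo.two_mul_mem_of_intCast_mul_mem (c := W.frobeniusTrace 2 - 3) (by omega) (hmem z hz)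

/-- **THE DERICKX–ORLIĆ EXPONENT LAW AT EVERY PRIME LEVEL `q ≥ 18`, `q ≢ 1 (mod 5)` (lattice-optimal data of globally minimal curves):**
`2Λ₀(f) ⊆ Λ₁(f) ∨ 3Λ₀(f) ⊆ Λ₁(f)` — UNCONDITIONAL.  The `a₂(W) = −2` case: `(a₂ − 3)Λ₀ = −5Λ₀ ⊆ Λ₁` and `φ(q)Λ₀ = (q − 1)Λ₀ ⊆ Λ₁`
(Ling–Oesterlé Thm. 1, tree `totient_mul_mem_periodLatticeGamma1`) with `5 ∤ q − 1` give `Λ₀ = Λ₁`; the other cases are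
`two_mul_mem_or_three_mul_mem_primeLevel_of_frobeniusTrace_two_ne`.  Sharp at `q ∈ {11, 17}` (`11a`: index `5`; `17a`: `ℤ/4`).
The only prime-level residue of E-es-193 left is `q ≡ 1 (mod 5) ∧ a₂(W) = −2` (Miyawaki's `5`-torsion classification).
[cite: LingOesterle1991, Thm. 1 and Thm. 6] [cite: Setzer1975, Thm 2] [cite: DerickxOrlic2025, Rmk. 4.8] -/
theorem two_mul_mem_or_three_mul_mem_primeLevel (D : ModularParametrizationData W q)
    (hopt : ∀ z ∈ D.L.lattice, ∃ w ∈ periodLattice D.f, z = D.c * w) (hq : q.Prime) (h18 : 18 ≤ q) (hq5 : q % 5 ≠ 1) :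
    (∀ z ∈ periodLattice D.f, 2 * z ∈ periodLatticeGamma1 D.f) ∨ (∀ z ∈ periodLattice D.f, 3 * z ∈ periodLatticeGamma1 D.f) := by
  by_cases ha : W.frobeniusTrace 2 = -2
  · obtain ⟨-, hmem⟩ := ShimuraIndexAtTwo.oddLevelEisensteinAtTwo W D.f D.isNewformOf (not_two_dvd_of_prime_level D hq)
    refine Or.inl fun z hz ↦ ?_
    have h5z : ((5 : ℕ) : ℂ) * z ∈ periodLatticeGamma1 D.f := by
      have h' := (periodLatticeGamma1 D.f).neg_mem (hmem z hz)
      rw [ha] at h'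
      convert h' using 1
      push_cast
      ring
    have htot : ((Nat.totient q : ℤ) : ℂ) * z ∈ periodLatticeGamma1 D.f := by
      exact_mod_cast totient_mul_mem_periodLatticeGamma1 D.f hz
    have h5tot : ¬ ((5 : ℕ) : ℤ) ∣ (Nat.totient q : ℤ) := by
      rw [Nat.totient_prime hq]
      intro h
      have h' : (5 : ℤ) ∣ ((q - 1 : ℕ) : ℤ) := by exact_mod_cast h
      have : 5 ∣ q - 1 := by exact_mod_cast h'
      omega
    have hz1 : z ∈ periodLatticeGamma1 D.f :=
      mem_of_intCast_mul_mem_of_prime_mul_mem (p := 5) (by norm_num) h5tot htot h5z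
    simpa [two_mul] using (periodLatticeGamma1 D.f).add_mem hz1 hz1
  · exact two_mul_mem_or_three_mul_mem_primeLevel_of_frobeniusTrace_two_ne D hopt hq (by omega) ha

end PrimeLevel

end Summit.BirchSwinnertonDyer.BirchSwinnertonDyer.Theorems.ManinLocalTwoThree.ShimuraPrimeLevelAtTwo

end
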